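import Summits.RiemannHypothesis.RiemannHypothesis.Theorems.PfPersistenceFfWeilCriterion
import Summits.RiemannHypothesis.RiemannHypothesis.Theorems.MotivicDoorFfWeilConverse

/-
# The two spellings of the functional equation, and the finite-depth criterion in FE form

pub-rhpf ffmirror-2 gen 5 — DICTIONARY helper requested by the pub-rhpf LEAD (g10, 17:45Z) and ruled by
pub-rhdoor ref-1 (REFEREE-1.md §C): the function-field converse Weil criterion for the window tower
landed twice on 2026-08-19 —

* `PfPersistenceFfWeilCriterion` (this cell): hypotheses `hrec : (frobRoots h).map (q/·) = frobRoots h`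
  (roots closed under `α ↦ q/α` AS A MULTISET) and `h0 : 0 ∉ frobRoots h`, real `q > 0`, ONE window of
  size `≥ deg h` (`weilWindowForm_posSemidef_iff`, `…_twoG_iff`) — citation of record for the
  equivalence and for the finite depth;
* `MotivicDoorFfWeilConverse` (pub-rhdoor ff-1): hypotheses `h.natDegree = 2g` and the functional
  equation ON COEFFICIENTS `∀ i j, i + j = 2g → q^g c_j = q^i c_i`, natural `q > 0`, all windows /
  bounded kernel (`ffRH_of_ffKernel_bounded`, `weilWindowForm_posSemidef_iff_ffRH`) — cited for the
  tail / kernel / minor forms, the FE typing and the membership-level dictionary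
  `frobRoots_reciprocal`, `frobRoots_ne_zero`.

This file supplies the one missing link named by both seats and re-derives nothing of either file:

* `fe_eval_reflect` — FE as the reflected evaluation identity `x^{2g} q^g P(q/x) = q^{2g} P(x)` at
  every `x ≠ 0` (`P = h ⊗ ℂ`);
* `frobRoots_map_div_of_fe` — **FE ⇒ `hrec` at the MULTISET level** (with multiplicities): from the
  identity above and the product form of `P` over `ℂ`, `q^{2g}·P = c · ∏_{α} (X − q/α)` as polynomials
  (equality at infinitely many points), hence equal root multisets;
* `weilWindowForm_posSemidef_iff_of_fe`, `…_twoG_iff_of_fe`, `…_not_posSemidef_of_fe_offCircle` — the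
  FINITE-DEPTH criterion in ff-1's FE spelling: for `deg h = 2g ≥ 2` with FE, the single window
  `M = 2g − 1` is positive semidefinite iff RH(q,h);
* `dictionary_oneway_witness` — the dictionary is ONE-WAY (ref-1's example, kernel form):
  `h = X² − 4`, `q = 4` satisfies `hrec ∧ h0` and violates FE.

HONEST FRAMING: mechanism/rigidity campaign; elementary algebra about polynomials over `ℂ`; nothing
here is a statement about ζ; no RH claim in either direction.
-/

set_option linter.dupNamespace false  -- the mandated namespace repeats `RiemannHypothesis`

noncomputable section

open Polynomial
open scoped ComplexOrder

open Summit.RiemannHypothesis.RiemannHypothesis.Theorems.MotivicDoor.FunctionField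
  (fe_complex frobRoots_ne_zero weilWindowForm_posSemidef_iff_ffRH)

namespace Summit.RiemannHypothesis.RiemannHypothesis.Theorems.PfPersistence.FfAngleTwin

/-! ### FE as a reflected evaluation identity, and the multiset-level dictionary -/

/-- THE FUNCTIONAL EQUATION AS A REFLECTED EVALUATION IDENTITY at every non-zero point:
`x^{2g} · q^g · P(q/x) = q^{2g} · P(x)` for `P = h ⊗ ℂ`. [folklore] -/
theorem fe_eval_reflect {q : ℕ} {h : ℤ[X]} {g : ℕ} (hdeg : h.natDegree = 2 * g)
    (hFE : ∀ i j, i + j = 2 * g → (q : ℤ) ^ g * h.coeff j = (q : ℤ) ^ i * h.coeff i)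
    {x : ℂ} (hx : x ≠ 0) :
    x ^ (2 * g) * (q : ℂ) ^ g * (h.map (Int.castRingHom ℂ)).eval ((q : ℂ) / x)
      = (q : ℂ) ^ (2 * g) * (h.map (Int.castRingHom ℂ)).eval x := by
  have hdegP : (h.map (Int.castRingHom ℂ)).natDegree = 2 * g := by
    rw [natDegree_map_eq_of_injective (Int.castRingHom ℂ).injective_int, hdeg]
  have hsum : ∀ y : ℂ, (h.map (Int.castRingHom ℂ)).eval y
      = ∑ i ∈ Finset.range (2 * g + 1), (h.map (Int.castRingHom ℂ)).coeff i * y ^ i := fun y =>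
    eval_eq_sum_range' (by rw [hdegP]; exact Nat.lt_succ_self _) y
  have hterm : ∀ i ∈ Finset.range (2 * g + 1),
      (h.map (Int.castRingHom ℂ)).coeff (2 * g + 1 - 1 - i)
          * (x ^ (2 * g) * (q : ℂ) ^ g * ((q : ℂ) / x) ^ (2 * g + 1 - 1 - i))
        = (q : ℂ) ^ (2 * g) * ((h.map (Int.castRingHom ℂ)).coeff i * x ^ i) := by
    intro i hi
    obtain ⟨k, hk⟩ : ∃ k, i + k = 2 * g :=
      ⟨2 * g - i, by have := Finset.mem_range.1 hi; omega⟩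
    have hki : 2 * g + 1 - 1 - i = k := by omega
    have hFEk : (q : ℂ) ^ g * (h.map (Int.castRingHom ℂ)).coeff k
        = (q : ℂ) ^ i * (h.map (Int.castRingHom ℂ)).coeff i := fe_complex hFE hk
    rw [hki, ← hk, pow_add, pow_add, div_pow]
    have hxk : x ^ k ≠ 0 := pow_ne_zero _ hx
    have e1 : x ^ i * x ^ k * (q : ℂ) ^ g * ((q : ℂ) ^ k / x ^ k) = x ^ i * (q : ℂ) ^ g * (q : ℂ) ^ k := by
      field_simp
    rw [e1]
    linear_combination (x ^ i * (q : ℂ) ^ k) * hFEk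
  rw [hsum, hsum, Finset.mul_sum, Finset.mul_sum, ← Finset.sum_range_reflect _ (2 * g + 1)]
  refine Finset.sum_congr rfl fun i hi => ?_
  rw [← hterm i hi]; ring

/-- DICTIONARY, MULTISET LEVEL: the functional equation on the coefficients of `h` (deg `h = 2g`)
closes the root multiset of `h` under `α ↦ q/α` *with multiplicities* — the hypothesis `hrec` of the
finite-depth criterion `weilWindowForm_posSemidef_iff`. [folklore] -/
theorem frobRoots_map_div_of_fe {q : ℕ} (hq : 0 < q) {h : ℤ[X]} {g : ℕ} (hdeg : h.natDegree = 2 * g)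
    (hFE : ∀ i j, i + j = 2 * g → (q : ℤ) ^ g * h.coeff j = (q : ℤ) ^ i * h.coeff i) :
    (frobRoots h).map (fun α => (q : ℂ) / α) = frobRoots h := by
  by_cases hh0 : h = 0
  · simp [frobRoots, hh0]
  have hP0 : h.map (Int.castRingHom ℂ) ≠ 0 := fun h0 => hh0 (Polynomial.map_injective _
    (Int.castRingHom ℂ).injective_int (by rw [h0, Polynomial.map_zero]))
  have hqC : (q : ℂ) ≠ 0 := by exact_mod_cast hq.ne'
  have hroots : (h.map (Int.castRingHom ℂ)).roots = frobRoots h := rfl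
  have hcard : Multiset.card (h.map (Int.castRingHom ℂ)).roots = (h.map (Int.castRingHom ℂ)).natDegree :=
    IsAlgClosed.card_roots_eq_natDegree
  have hcard' : Multiset.card (frobRoots h) = 2 * g := by rw [card_frobRoots_eq_natDegree, hdeg]
  have hne0 : ∀ α ∈ frobRoots h, α ≠ 0 := frobRoots_ne_zero hq hdeg hFE
  -- product form of `P = h ⊗ ℂ`
  have hprod : C (h.map (Int.castRingHom ℂ)).leadingCoeff * ((frobRoots h).map fun a => X - C a).prod
      = h.map (Int.castRingHom ℂ) := by
    rw [← hroots]; exact C_leadingCoeff_mul_prod_multiset_X_sub_C hcard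
  -- the constant `c = ∏ (-α)` and the reflected polynomial `Q`
  have hc0 : ((frobRoots h).map fun a => -a).prod ≠ 0 := by
    rw [Ne, Multiset.prod_eq_zero_iff, Multiset.mem_map]
    rintro ⟨a, ha, ha0⟩
    exact hne0 a ha (neg_eq_zero.1 ha0)
  have hlc : (q : ℂ) ^ g * (h.map (Int.castRingHom ℂ)).leadingCoeff
      * ((frobRoots h).map fun a => -a).prod ≠ 0 :=
    mul_ne_zero (mul_ne_zero (pow_ne_zero _ hqC) (leadingCoeff_ne_zero.2 hP0)) hc0
  -- pointwise identity on `x ≠ 0`:  `q^{2g} P(x) = Q(x)`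
  have hpt : ∀ x : ℂ, x ≠ 0 →
      (C ((q : ℂ) ^ (2 * g)) * h.map (Int.castRingHom ℂ)).eval x
        = (C ((q : ℂ) ^ g * (h.map (Int.castRingHom ℂ)).leadingCoeff * ((frobRoots h).map fun a => -a).prod)
            * ((frobRoots h).map fun a => X - C ((q : ℂ) / a)).prod).eval x := by
    intro x hx
    have hrefl := fe_eval_reflect hdeg hFE hx
    have hPev : (h.map (Int.castRingHom ℂ)).eval ((q : ℂ) / x)
        = (h.map (Int.castRingHom ℂ)).leadingCoeff * ((frobRoots h).map fun a => (q : ℂ) / x - a).prod := by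
      conv_lhs => rw [← hprod]
      rw [eval_mul, eval_C, eval_multiset_prod, Multiset.map_map]
      congr 1
      exact congr_arg _ (Multiset.map_congr rfl fun a _ => by simp)
    have hQev : (C ((q : ℂ) ^ g * (h.map (Int.castRingHom ℂ)).leadingCoeff * ((frobRoots h).map fun a => -a).prod)
            * ((frobRoots h).map fun a => X - C ((q : ℂ) / a)).prod).eval x
        = (q : ℂ) ^ g * (h.map (Int.castRingHom ℂ)).leadingCoeff * ((frobRoots h).map fun a => -a).prod
            * ((frobRoots h).map fun a => x - (q : ℂ) / a).prod := by
      rw [eval_mul, eval_C, eval_multiset_prod, Multiset.map_map]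
      congr 1
      exact congr_arg _ (Multiset.map_congr rfl fun a _ => by simp)
    have hxpow : x ^ (2 * g) = ((frobRoots h).map fun _ => x).prod := by
      rw [Multiset.map_const', Multiset.prod_replicate, hcard']
    have step1 : x ^ (2 * g) * ((frobRoots h).map fun a => (q : ℂ) / x - a).prod
        = ((frobRoots h).map fun a => ((q : ℂ) - a * x)).prod := by
      rw [hxpow, ← Multiset.prod_map_mul]
      refine congr_arg _ (Multiset.map_congr rfl fun a _ => ?_)
      field_simp
    have step2 : ((frobRoots h).map fun a => ((q : ℂ) - a * x)).prod
        = ((frobRoots h).map fun a => -a).prod * ((frobRoots h).map fun a => x - (q : ℂ) / a).prod := by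
      rw [← Multiset.prod_map_mul]
      refine congr_arg _ (Multiset.map_congr rfl fun a ha => ?_)
      have ha0 := hne0 a ha
      field_simp
      ring
    rw [eval_mul, eval_C, ← hrefl, hPev, hQev]
    calc x ^ (2 * g) * (q : ℂ) ^ g
          * ((h.map (Int.castRingHom ℂ)).leadingCoeff * ((frobRoots h).map fun a => (q : ℂ) / x - a).prod)
        = (q : ℂ) ^ g * (h.map (Int.castRingHom ℂ)).leadingCoeff
            * (x ^ (2 * g) * ((frobRoots h).map fun a => (q : ℂ) / x - a).prod) := by ring
      _ = (q : ℂ) ^ g * (h.map (Int.castRingHom ℂ)).leadingCoeff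
            * (((frobRoots h).map fun a => -a).prod * ((frobRoots h).map fun a => x - (q : ℂ) / a).prod) := by
          rw [step1, step2]
      _ = _ := by ring
  -- hence a polynomial identity
  have hpoly : C ((q : ℂ) ^ (2 * g)) * h.map (Int.castRingHom ℂ)
      = C ((q : ℂ) ^ g * (h.map (Int.castRingHom ℂ)).leadingCoeff * ((frobRoots h).map fun a => -a).prod)
          * ((frobRoots h).map fun a => X - C ((q : ℂ) / a)).prod := by
    apply Polynomial.eq_of_infinite_eval_eq
    haveI : Infinite ℂ := Infinite.of_injective _ Nat.cast_injective
    exact ((Set.finite_singleton (0:ℂ)).infinite_compl).mono fun x hx => hpt x hx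
  -- read the root multisets off both sides
  have hmm : ((frobRoots h).map fun a => X - C ((q : ℂ) / a))
      = ((frobRoots h).map fun a => (q : ℂ) / a).map fun a => X - C a := by
    rw [Multiset.map_map]; rfl
  have hR := congr_arg Polynomial.roots hpoly
  rw [roots_C_mul _ (pow_ne_zero _ hqC), roots_C_mul _ hlc, hmm, roots_multiset_prod_X_sub_C,
    hroots] at hR
  exact hR.symm


/-- `0` is not a root under FE (ff-1's `frobRoots_ne_zero`, in the `∉` spelling of the criterion). -/
theorem zero_not_mem_frobRoots_of_fe {q : ℕ} (hq : 0 < q) {h : ℤ[X]} {g : ℕ} (hdeg : h.natDegree = 2 * g)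
    (hFE : ∀ i j, i + j = 2 * g → (q : ℤ) ^ g * h.coeff j = (q : ℤ) ^ i * h.coeff i) :
    (0 : ℂ) ∉ frobRoots h := fun h0 => frobRoots_ne_zero hq hdeg hFE 0 h0 rfl

/-- Cast form of the dictionary, exactly as the criterion (stated over real `q`) consumes it. -/
theorem frobRoots_map_div_of_fe_real {q : ℕ} (hq : 0 < q) {h : ℤ[X]} {g : ℕ} (hdeg : h.natDegree = 2 * g)
    (hFE : ∀ i j, i + j = 2 * g → (q : ℤ) ^ g * h.coeff j = (q : ℤ) ^ i * h.coeff i) :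
    (frobRoots h).map (fun α => (((q : ℕ) : ℝ) : ℂ) / α) = frobRoots h := by
  simpa only [Complex.ofReal_natCast] using frobRoots_map_div_of_fe hq hdeg hFE

/-! ### The finite-depth criterion in FE spelling -/

/-- FINITE-DEPTH WEIL CRITERION, FE SPELLING: for `deg h = 2g` with the coefficient functional equation,
ANY single window of size `≥ 2g` is positive semidefinite iff every root has absolute value `√q`.
(`weilWindowForm_posSemidef_iff` + the dictionary.) [folklore] -/
theorem weilWindowForm_posSemidef_iff_of_fe {q : ℕ} (hq : 0 < q) {h : ℤ[X]} {g : ℕ}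
    (hdeg : h.natDegree = 2 * g)
    (hFE : ∀ i j, i + j = 2 * g → (q : ℤ) ^ g * h.coeff j = (q : ℤ) ^ i * h.coeff i)
    {M : ℕ} (hM : 2 * g ≤ M + 1) :
    (weilWindowForm (q : ℝ) h M).PosSemidef ↔ ∀ α ∈ frobRoots h, ‖α‖ = Real.sqrt q :=
  weilWindowForm_posSemidef_iff (Nat.cast_pos.2 hq) (frobRoots_map_div_of_fe_real hq hdeg hFE)
    (zero_not_mem_frobRoots_of_fe hq hdeg hFE) (by omega)

/-- … in particular THE ONE WINDOW `M = 2g − 1` (size `2g = deg h`) decides RH(q,h) under FE. [folklore] -/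
theorem weilWindowForm_posSemidef_twoG_iff_of_fe {q : ℕ} (hq : 0 < q) {h : ℤ[X]} {g : ℕ} (hg : 1 ≤ g)
    (hdeg : h.natDegree = 2 * g)
    (hFE : ∀ i j, i + j = 2 * g → (q : ℤ) ^ g * h.coeff j = (q : ℤ) ^ i * h.coeff i) :
    (weilWindowForm (q : ℝ) h (2 * g - 1)).PosSemidef ↔ ∀ α ∈ frobRoots h, ‖α‖ = Real.sqrt q :=
  weilWindowForm_posSemidef_iff_of_fe hq hdeg hFE (by omega)

/-- … and an off-circle root is visible on every window of size `≥ 2g`. [folklore] -/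
theorem weilWindowForm_not_posSemidef_of_fe_offCircle {q : ℕ} (hq : 0 < q) {h : ℤ[X]} {g : ℕ}
    (hdeg : h.natDegree = 2 * g)
    (hFE : ∀ i j, i + j = 2 * g → (q : ℤ) ^ g * h.coeff j = (q : ℤ) ^ i * h.coeff i)
    (hoff : ∃ α ∈ frobRoots h, ‖α‖ ≠ Real.sqrt q) {M : ℕ} (hM : 2 * g ≤ M + 1) :
    ¬ (weilWindowForm (q : ℝ) h M).PosSemidef := fun hpsd => by
  obtain ⟨α, hα, hne⟩ := hoff
  exact hne ((weilWindowForm_posSemidef_iff_of_fe hq hdeg hFE hM).1 hpsd α hα)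

/-- The `∀ M` form in FE spelling is ff-1's `weilWindowForm_posSemidef_iff_ffRH` (cited, not re-proved);
recorded here only as the remark that it is the `M`-uniform reading of the finite statement. -/
example {q : ℕ} (hq : 0 < q) {h : ℤ[X]} {g : ℕ} (hdeg : h.natDegree = 2 * g)
    (hFE : ∀ i j, i + j = 2 * g → (q : ℤ) ^ g * h.coeff j = (q : ℤ) ^ i * h.coeff i) :
    (∀ M, (weilWindowForm (q : ℝ) h M).PosSemidef) ↔ ∀ α ∈ frobRoots h, ‖α‖ = Real.sqrt q :=
  weilWindowForm_posSemidef_iff_ffRH hq hdeg hFE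

/-! ### The dictionary is one-way -/

/-- THE DICTIONARY IS ONE-WAY (ref-1's example, kernel form): `h = X² − 4`, `q = 4`, `g = 1` has its
roots `{2, −2}` closed under `α ↦ 4/α` as a multiset and `0 ∉ roots`, but violates the coefficient FE
(`4 · c₀ = −16 ≠ 16 = 4² · c₂`). [folklore] -/
theorem dictionary_oneway_witness :
    (frobRoots (X ^ 2 - C 4 : ℤ[X])).map (fun α => ((4 : ℕ) : ℂ) / α) = frobRoots (X ^ 2 - C 4 : ℤ[X])
    ∧ (0 : ℂ) ∉ frobRoots (X ^ 2 - C 4 : ℤ[X])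
    ∧ (X ^ 2 - C 4 : ℤ[X]).natDegree = 2 * 1
    ∧ ¬ (∀ i j, i + j = 2 * 1 →
        ((4 : ℕ) : ℤ) ^ 1 * (X ^ 2 - C 4 : ℤ[X]).coeff j
          = ((4 : ℕ) : ℤ) ^ i * (X ^ 2 - C 4 : ℤ[X]).coeff i) := by
  have hmap : (X ^ 2 - C 4 : ℤ[X]).map (Int.castRingHom ℂ)
      = (({2, -2} : Multiset ℂ).map fun a => X - C a).prod := by
    have e : (X ^ 2 - C 4 : ℤ[X]).map (Int.castRingHom ℂ) = X ^ 2 - C 4 := by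
      rw [Polynomial.map_sub, Polynomial.map_pow, Polynomial.map_X, Polynomial.map_C, eq_intCast,
        Int.cast_ofNat]
    rw [e]
    simp only [Multiset.insert_eq_cons, Multiset.map_cons, Multiset.map_singleton, Multiset.prod_cons,
      Multiset.prod_singleton, map_neg, sub_neg_eq_add]
    have hC : (C (2:ℂ)) * (C (2:ℂ)) = C 4 := by rw [← C_mul]; norm_num
    linear_combination hC
  have hroots : frobRoots (X ^ 2 - C 4 : ℤ[X]) = {2, -2} := by
    unfold frobRoots; rw [hmap, roots_multiset_prod_X_sub_C]
  refine ⟨?_, ?_, ?_, ?_⟩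
  · rw [hroots]
    simp only [Multiset.insert_eq_cons, Multiset.map_cons, Multiset.map_singleton]
    norm_num
  · rw [hroots]; norm_num
  · have : (X ^ 2 - C 4 : ℤ[X]).natDegree = 2 := by
      rw [natDegree_sub_C, natDegree_X_pow]
    omega
  · intro hFE
    have h1 := hFE 2 0 (by norm_num)
    rw [coeff_sub, coeff_sub, coeff_X_pow, coeff_X_pow, coeff_C, coeff_C] at h1
    norm_num at h1

end Summit.RiemannHypothesis.RiemannHypothesis.Theorems.PfPersistence.FfAngleTwin

end
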